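import Literature.MathematicalPhysics.QuantumFieldTheory.Balaban1983to89.Node00.MultiScaleFibreChartMultiplier
import Literature.MathematicalPhysics.QuantumFieldTheory.Balaban1983to89.B15Prop1DatumCoordinates
import Literature.MathematicalPhysics.QuantumFieldTheory.Balaban1983to89.B15Claim189UnitTestAtRecord

/-!
# NODE 00 — ONE CHART-CURVATURE CONSTANT PER HEIGHT for the canonical chart `Ψ := msChart F N K k 𝐁 W U₀` of the multi-scale constraint: `‖D²Ψ(0)(w,w)‖ ≤ M₂(F,K,k,N)·‖w‖²` for ALL
# determining sets of levels `≤ k`, ALL fibre data `W`, ALL backgrounds `U₀` in a sup-norm ball around the flat configuration — the (μ) analogue of dag-n10-w1's «ONE ρ′ per height»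

[Balaban1985Variational] = «[15]», Sect. C (44)–(48) p. 285, (81)–(83) p. 290, (170)–(171) p. 305; [Balaban1989LargeFieldII] = «[LF-II]», (1.12) p. 359, p. 357; [Balaban1987RG1] (0.4) p. 253,
(0.21) p. 256; [Balaban1988Convergent] = «[III]», (2.10)–(2.12) p. 256.  Cell `pub-ymgap`, HUMAN RULING D-0062 ∕ D-0149, width seat `pub-ymgap-dag-n12-w4` generation 3 (N12 = [B15]; lane U2c;
INBOX CLAIM-4 ∕ INTENT-4 of 2026-08-28 = the lane owner's word (β) on ASK-1).  `--kind proof --supports stmt-QuantumFields-20542` (K1⁷; count-neutral helper).  NEW leaf; CONSUMED BY NAME: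
this seat's `Node00.MultiScaleFibreChartMultiplier` (p613093) ∕ `…Lagrange` (p610492: `hasFDerivAt_fderiv_msChart`, `eventually_differentiableAt_msChart`), n07-w2's `Node00.MultiScaleFibreChart`
(`msChart_apply`, `relAvg_expChart_eq_of_smallBelow`, `eventually_smallBelow_expChart`), dag-n12-w1's `B15AveragingHolomorphic` ∕ `B15AveragingAnalytic` ∕ `B15Prop1DatumCoordinates` (`iterMh`,
`contDiffAt_iterMh_of_polydisc`, `iterMh_coeField_eq_iterM`, `coeField_iter_eq_iterMh`, `eventually_polydisc`, `eventually_smallBelow`), `B15Claim189UnitTestAtRecord.iter_avOfRecord_one`,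
`T3DescentFibreTower.small_one`, `MatrixLog.analyticAt_mlog`.

WHY.  p613093 closed the (μ) row of the near-flat one-sided (1.7) skeleton at the EXISTENCE level with a chart-curvature constant PER INSTANCE.  The lane owner's word (ASK-1 → (β)): ONE constant
per height, uniform over the backgrounds in the guard ball, the fibre data and the determining sets — by continuity and compactness, as for (J0′) (`B15Prop1ClosedGuardUniformRadius`) and as
dag-n10-w1's F-module.  THE POINT: the `(j,c)`-component of the chart depends on `(U₀, W)` only through the matrix field `↑U₀` — on the fibre `W_j(c) = M˙(U₀)_j(c)`, and under the guard the
averages are the holomorphic iterate `M_h^j(↑U₀)` — so every component is ONE smooth function of `(↑U₀, X)` from the FINITE menu `(j ≤ k, c)`, independent of `𝐁`; its second `X`-derivative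
at `0` is continuous in `↑U₀`, hence bounded on the compact ball `‖↑U₀ − 1‖ ≤ ρ″` of matrix fields.

CONTENTS (namespace `…Node00`; theorems only — no `def`, no `instance`, no `notation`, no `sorry`).  §1 [folklore] ★ `exists_sq_bound_on_compact_of_contDiffAt_two` (uniform diagonal bound of a
parameter-dependent second derivative over a compact parameter set), ★ `fderiv_fderiv_apply_pi` (components of a `Π`-valued second derivative), `fderiv_fderiv_congr_of_eventuallyEq`.
§2 `coeField_expChart_eq_mulExp`, `contDiff_mulExp`, `mulExp_zero`, ★ `contDiffAt_chartModel` (joint `C^∞` of `(V, X) ↦ π(log((M_h^j V c)*·M_h^j(V ⊙ e^X)(c)))` on the polydisc with `log`-argument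
near `1`), ★ `eventually_msChart_apply_eq_chartModel` (on the fibre, under the guard, the chart IS the model at `V := ↑U₀`).  §3 `eventually_smallBelow_near_one`, ★ `exists_radius_chartModel`
(ONE `ρ″`: guard, polydisc and `log`-domain below it).  §4 ★★★ `exists_uniform_chartCurvature_sq_bound` (+ the guard clause), `…_seminorm` (`≤ N·M₂·p(w)²`), ★★ `exists_uniform_lam_mu_msChart`
(p613093 §4 with THIS `M₂`: `μ∕(j·ρ) = N·M₂` uniform per height).

HONEST FRAMING ∕ LOCATED: per-HEIGHT constants by compactness of a finite 𝕋⁴ (they depend on `F.P K` and `k`, NOT on the background, the datum or the determining set); print's VOLUME-uniform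
`O(1)` curvature of the averaging chart ([15] Sect. C (48), Sect. G) is NOT claimed — the located item (γ) of plan's row N12.  Nothing of Bałaban's asserted; N12 NOT discharged; K1⁷ NOT
closed; counts unmoved (5∕27); one finite 𝕋⁴ programme at fixed ε — R4 closes the conditional rung `BalabanLadder.UV` only; NOT continuum ∕ ℝ⁴ ∕ OS ∕ mass gap ∕ Clay.
-/


noncomputable section

namespace Literature.MathematicalPhysics.QuantumFieldTheory.Balaban1983to89.Node00

open Filter Topology Metric
open T4Continuum (T4Family)
open B15DeterminingSets
open T4AdjointCovarianceUnitary (lieSU)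
open MatrixLog (mlog analyticAt_mlog)
open B15AveragingHolomorphic (iterMh loopMh iterMh_coeField_eq_iterM coeField_iter_eq_iterMh)
open B15AveragingAnalytic (contDiffAt_iterMh_of_polydisc)
open B15Prop1DatumCoordinates (eventually_polydisc eventually_smallBelow)
open BlockAveraging (blockAvg Idx)
open ExpMeanLog (expMeanLogSU)
open B14.Eq213DetSet (Bj Bj_of_gt)
open scoped Matrix.Norms.L2Operator BigOperators
/-! ## §1  Generic calculus: a uniform bound for a parameter-dependent second derivative; components of a `Π`-valued second derivative -/

section Generic

variable {E X V : Type*} [NormedAddCommGroup E] [NormedSpace ℝ E] [NormedAddCommGroup X] [NormedSpace ℝ X]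
  [NormedAddCommGroup V] [NormedSpace ℝ V]

/-- ★ **A UNIFORM BOUND FOR A PARAMETER-DEPENDENT SECOND DERIVATIVE ON A COMPACT PARAMETER SET** [folklore]: if `(a, x) ↦ f a x` is `C²` at `(a, 0)` for every `a` in a compact `S`, then
`‖D²(f a)(0)(w,w)‖ ≤ C‖w‖²` with ONE `C` for all `a ∈ S` (`ContDiffAt.fderiv` twice; `(a, u) ↦ ‖D²(f a)(0)(u,u)‖` is bounded on `S × B̄(0,1)`; `w = ‖w‖·u`). [cite: Balaban1985Variational, (81) p.290 (bookkeeping)] -/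
theorem exists_sq_bound_on_compact_of_contDiffAt_two [FiniteDimensional ℝ X] (f : E → X → V) {S : Set E} (hS : IsCompact S)
    (hf : ∀ a ∈ S, ContDiffAt ℝ 2 (Function.uncurry f) (a, 0)) :
    ∃ C : ℝ, 0 ≤ C ∧ ∀ a ∈ S, ∀ w : X, ‖fderiv ℝ (fderiv ℝ (f a)) 0 w w‖ ≤ C * ‖w‖ ^ 2 := by
  have hcont : ∀ a ∈ S, ∀ u : X,
      ContinuousAt (fun p : E × X => ‖fderiv ℝ (fderiv ℝ (f p.1)) (0 : X) p.2 p.2‖) (a, u) := by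
    intro a ha u
    have h1 : ContDiffAt ℝ 1 (fun p : E × X => fderiv ℝ (f p.1) p.2) (a, 0) := by
      have hu : ContDiffAt ℝ 2 (Function.uncurry fun (p : E × X) (y : X) => f p.1 y) ((a, (0 : X)), (0 : X)) := by
        have hlin : ContDiff ℝ 2 (fun q : (E × X) × X => (q.1.1, q.2)) :=
          (contDiff_fst.comp contDiff_fst).prodMk contDiff_snd
        have heq : (Function.uncurry fun (p : E × X) (y : X) => f p.1 y) =
            Function.uncurry f ∘ fun q : (E × X) × X => (q.1.1, q.2) := rfl
        rw [heq]
        exact ContDiffAt.comp ((a, (0 : X)), (0 : X)) (hf a ha) hlin.contDiffAt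
      exact hu.fderiv contDiffAt_snd (by norm_num)
    have h2 : ContDiffAt ℝ 0 (fun a' : E => fderiv ℝ (fun x : X => fderiv ℝ (f a') x) 0) a := by
      have hu : ContDiffAt ℝ 1 (Function.uncurry fun (a' : E) (x : X) => fderiv ℝ (f a') x) (a, (0 : X)) := h1
      exact hu.fderiv contDiffAt_const (by norm_num)
    have h3 : ContinuousAt (fun p : E × X => fderiv ℝ (fun x : X => fderiv ℝ (f p.1) x) 0) (a, u) :=
      h2.continuousAt.comp_of_eq continuousAt_fst rfl
    have h4 : ContinuousAt (fun p : E × X => fderiv ℝ (fun x : X => fderiv ℝ (f p.1) x) 0 p.2 p.2) (a, u) :=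
      (h3.clm_apply continuousAt_snd).clm_apply continuousAt_snd
    exact h4.norm
  have hK : IsCompact (S ×ˢ closedBall (0 : X) 1) := hS.prod (isCompact_closedBall _ _)
  have hcontOn : ContinuousOn (fun p : E × X => ‖fderiv ℝ (fderiv ℝ (f p.1)) (0 : X) p.2 p.2‖) (S ×ˢ closedBall (0 : X) 1) :=
    fun p hp => (hcont p.1 hp.1 p.2).continuousWithinAt
  obtain ⟨C₀, hC₀⟩ := hK.exists_bound_of_continuousOn hcontOn
  refine ⟨max C₀ 0, le_max_right _ _, fun a ha w => ?_⟩
  by_cases hw : w = 0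
  · subst hw; simp
  · have hnw : 0 < ‖w‖ := norm_pos_iff.2 hw
    obtain ⟨u, hu⟩ : ∃ u : X, u = ‖w‖⁻¹ • w := ⟨_, rfl⟩
    have hu1 : ‖u‖ ≤ 1 := by
      rw [hu, norm_smul, norm_inv, norm_norm, inv_mul_cancel₀ hnw.ne']
    have hmem : (a, u) ∈ S ×ˢ closedBall (0 : X) 1 := ⟨ha, by simpa using hu1⟩
    have hb := hC₀ (a, u) hmem
    rw [Real.norm_eq_abs] at hb
    have hb' : ‖fderiv ℝ (fderiv ℝ (f a)) (0 : X) u u‖ ≤ max C₀ 0 := ((le_abs_self _).trans hb).trans (le_max_left _ _)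
    have hwu : ‖w‖ • u = w := by rw [hu, smul_smul, mul_inv_cancel₀ hnw.ne', one_smul]
    have hexp : fderiv ℝ (fderiv ℝ (f a)) (0 : X) (‖w‖ • u) (‖w‖ • u) = (‖w‖ * ‖w‖) • fderiv ℝ (fderiv ℝ (f a)) (0 : X) u u := by
      rw [map_smul, map_smul, smul_apply, smul_smul]
    rw [← hwu, hexp, norm_smul, Real.norm_eq_abs, abs_of_nonneg (by positivity)]
    have hn : ‖‖w‖ • u‖ = ‖w‖ := by rw [hwu]
    rw [hn]
    calc ‖w‖ * ‖w‖ * ‖fderiv ℝ (fderiv ℝ (f a)) 0 u u‖ ≤ ‖w‖ * ‖w‖ * max C₀ 0 := by gcongr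
      _ = max C₀ 0 * ‖w‖ ^ 2 := by ring

/-- ★ **COMPONENTS OF THE SECOND DERIVATIVE OF A `Π`-VALUED MAP** [folklore]: for `Φ : X → Π i, V` differentiable near `x₀` with `DΦ` differentiable at `x₀`,
`(D²Φ(x₀)(w,w′))_i = D²(Φ_i)(x₀)(w,w′)` (the `i`-th component is the projection `π_i`, a continuous linear map, composed with `Φ`). [cite: Balaban1985Variational, (81) p.290 (bookkeeping)] -/
theorem fderiv_fderiv_apply_pi {ι : Type*} [Fintype ι] {Φ : X → ι → V} {x₀ : X}
    (hd : ∀ᶠ x in 𝓝 x₀, DifferentiableAt ℝ Φ x) (hd2 : DifferentiableAt ℝ (fderiv ℝ Φ) x₀) (i : ι) (w w' : X) :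
    fderiv ℝ (fderiv ℝ Φ) x₀ w w' i = fderiv ℝ (fderiv ℝ (fun x => Φ x i)) x₀ w w' := by
  set π : (ι → V) →L[ℝ] V := ContinuousLinearMap.proj i with hπ
  have h1 : (fun x => fderiv ℝ (fun x => Φ x i) x) =ᶠ[𝓝 x₀] fun x => (ContinuousLinearMap.compL ℝ X (ι → V) V π) (fderiv ℝ Φ x) := by
    filter_upwards [hd] with x hx
    have h := (π.hasFDerivAt.comp x hx.hasFDerivAt).fderiv
    exact h
  have h2 : HasFDerivAt (fun x => (ContinuousLinearMap.compL ℝ X (ι → V) V π) (fderiv ℝ Φ x))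
      ((ContinuousLinearMap.compL ℝ X (ι → V) V π).comp (fderiv ℝ (fderiv ℝ Φ) x₀)) x₀ :=
    (ContinuousLinearMap.compL ℝ X (ι → V) V π).hasFDerivAt.comp x₀ hd2.hasFDerivAt
  have h3 : fderiv ℝ (fderiv ℝ (fun x => Φ x i)) x₀ = (ContinuousLinearMap.compL ℝ X (ι → V) V π).comp (fderiv ℝ (fderiv ℝ Φ) x₀) := by
    rw [show fderiv ℝ (fun x => Φ x i) = fun x => fderiv ℝ (fun x => Φ x i) x from rfl, h1.fderiv_eq, h2.fderiv]
  rw [h3]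
  rfl

/-- Second derivatives of eventually equal functions agree (twice `Filter.EventuallyEq.fderiv`). [cite: Balaban1985Variational, (81) p.290 (bookkeeping)] -/
theorem fderiv_fderiv_congr_of_eventuallyEq {φ ψ : X → V} {x₀ : X} (h : φ =ᶠ[𝓝 x₀] ψ) :
    fderiv ℝ (fderiv ℝ φ) x₀ = fderiv ℝ (fderiv ℝ ψ) x₀ :=
  h.fderiv.fderiv_eq

end Generic

/-! ## §2  The model: every component of the chart is one smooth function of `(↑U₀, X)` from the finite menu `(j, c)` -/

section Model

variable {F : T4Family} {N : ℕ} [NeZero N] {K : ℕ}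

omit [NeZero N] in
/-- `↑(U·e^X) = ↑U ⊙ e^X` bond-wise (n07-e's `coe_expChart`, as a matrix-field identity). [cite: Balaban1985RegularSpaces, (1.10) p.77 (bookkeeping)] -/
theorem coeField_expChart_eq_mulExp (U : GaugeField (F.P K) 0 (SU N)) (X : PBond (F.P K) 0 → lieSU (Fin N)) :
    coeField (expChart U X) = fun b => coeField U b * NormedSpace.exp ((X b : lieSU (Fin N)) : Matrix (Fin N) (Fin N) ℂ) := by
  funext b; rfl

omit [NeZero N] in
/-- The twisted exponential family `(V, X) ↦ V ⊙ e^X` is `C^∞` jointly (bond-wise product of a coordinate and the exponential of a coordinate). [cite: Balaban1985RegularSpaces, (1.10) p.77 (bookkeeping)] -/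
theorem contDiff_mulExp :
    ContDiff ℝ ⊤ (fun p : (PBond (F.P K) 0 → Matrix (Fin N) (Fin N) ℂ) × (PBond (F.P K) 0 → lieSU (Fin N)) =>
      fun b => p.1 b * NormedSpace.exp ((p.2 b : lieSU (Fin N)) : Matrix (Fin N) (Fin N) ℂ)) := by
  refine contDiff_pi.2 fun b => ?_
  have h1 : ContDiff ℝ ⊤ (fun p : (PBond (F.P K) 0 → Matrix (Fin N) (Fin N) ℂ) × (PBond (F.P K) 0 → lieSU (Fin N)) => p.1 b) :=
    (contDiff_apply ℝ (Matrix (Fin N) (Fin N) ℂ) b).comp contDiff_fst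
  have hval : ContDiff ℝ ⊤ (fun p : (PBond (F.P K) 0 → Matrix (Fin N) (Fin N) ℂ) × (PBond (F.P K) 0 → lieSU (Fin N)) =>
      ((p.2 b : lieSU (Fin N)) : Matrix (Fin N) (Fin N) ℂ)) :=
    (((lieSU (Fin N)).subtypeL.contDiff).comp (contDiff_apply ℝ (lieSU (Fin N)) b)).comp contDiff_snd
  have hexp : ContDiff ℝ ⊤ (NormedSpace.exp : Matrix (Fin N) (Fin N) ℂ → Matrix (Fin N) (Fin N) ℂ) :=
    contDiff_iff_contDiffAt.2 fun Y => ((NormedSpace.exp_analytic (𝕂 := ℂ) Y).contDiffAt).restrict_scalars ℝ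
  exact h1.mul (hexp.comp hval)

omit [NeZero N] in
/-- At `X = 0` the twisted exponential family is `V` itself. [cite: Balaban1985RegularSpaces, (1.10) p.77 (bookkeeping)] -/
theorem mulExp_zero (V : PBond (F.P K) 0 → Matrix (Fin N) (Fin N) ℂ) :
    (fun b => V b * NormedSpace.exp (((0 : PBond (F.P K) 0 → lieSU (Fin N)) b : lieSU (Fin N)) : Matrix (Fin N) (Fin N) ℂ)) = V := by
  funext b
  simp [NormedSpace.exp_zero]

omit [NeZero N] in
/-- ★ **THE CHART MODEL IS JOINTLY `C^∞`**: the `(j,c)`-model `(V, X) ↦ π(log((M_h^j V c)* · M_h^j(V ⊙ e^X)(c)))` is `C^∞` at `(V₀, 0)` whenever `V₀` lies in the polydisc below `j` (dag-n12-w1's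
`contDiffAt_iterMh_of_polydisc`) and `(M_h^j V₀ c)*·M_h^j V₀ c` is within `1` of `1` (`MatrixLog.analyticAt_mlog`). [cite: Balaban1987RG1, (0.4) p.253; Balaban1985Averaging, (21) p.21; Balaban1985Variational, Sect. C p.285, Prop. 9 p.309] -/
theorem contDiffAt_chartModel {j : ℕ} (c : PBond (F.P K) j) {V₀ : PBond (F.P K) 0 → Matrix (Fin N) (Fin N) ℂ}
    (hpoly : ∀ j', j' < j → ∀ (c' : PBond (F.P K) (j' + 1)) (i : Idx (F.P K)), ‖loopMh (iterMh j' V₀) c' i - 1‖ < 1)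
    (hlog : ‖star (iterMh j V₀ c) * iterMh j V₀ c - 1‖ < 1) :
    ContDiffAt ℝ ⊤ (Function.uncurry fun (V : PBond (F.P K) 0 → Matrix (Fin N) (Fin N) ℂ) (X : PBond (F.P K) 0 → lieSU (Fin N)) =>
      suProj N (mlog (star (iterMh j V c) * iterMh j (fun b => V b * NormedSpace.exp ((X b : lieSU (Fin N)) : Matrix (Fin N) (Fin N) ℂ)) c)))
      (V₀, 0) := by
  have hiter : ContDiffAt ℝ ⊤ (fun V : PBond (F.P K) 0 → Matrix (Fin N) (Fin N) ℂ => iterMh j V c) V₀ :=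
    ((contDiff_apply ℝ (Matrix (Fin N) (Fin N) ℂ) c).contDiffAt.comp V₀ ((contDiffAt_iterMh_of_polydisc j hpoly).restrict_scalars ℝ))
  have hA : ContDiffAt ℝ ⊤ (fun p : (PBond (F.P K) 0 → Matrix (Fin N) (Fin N) ℂ) × (PBond (F.P K) 0 → lieSU (Fin N)) =>
      star (iterMh j p.1 c)) (V₀, 0) := by
    have h := hiter.comp (V₀, (0 : PBond (F.P K) 0 → lieSU (Fin N))) contDiffAt_fst
    exact ((starL' ℝ : Matrix (Fin N) (Fin N) ℂ ≃L[ℝ] Matrix (Fin N) (Fin N) ℂ).toContinuousLinearMap.contDiff.contDiffAt).comp _ h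
  have hB : ContDiffAt ℝ ⊤ (fun p : (PBond (F.P K) 0 → Matrix (Fin N) (Fin N) ℂ) × (PBond (F.P K) 0 → lieSU (Fin N)) =>
      iterMh j (fun b => p.1 b * NormedSpace.exp ((p.2 b : lieSU (Fin N)) : Matrix (Fin N) (Fin N) ℂ)) c) (V₀, 0) := by
    have h0 : (fun b => (V₀, (0 : PBond (F.P K) 0 → lieSU (Fin N))).1 b *
        NormedSpace.exp ((((V₀, (0 : PBond (F.P K) 0 → lieSU (Fin N))).2 b : lieSU (Fin N)) : Matrix (Fin N) (Fin N) ℂ))) = V₀ :=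
      mulExp_zero V₀
    have hiter' : ContDiffAt ℝ ⊤ (fun V : PBond (F.P K) 0 → Matrix (Fin N) (Fin N) ℂ => iterMh j V c)
        (fun b => (V₀, (0 : PBond (F.P K) 0 → lieSU (Fin N))).1 b *
          NormedSpace.exp ((((V₀, (0 : PBond (F.P K) 0 → lieSU (Fin N))).2 b : lieSU (Fin N)) : Matrix (Fin N) (Fin N) ℂ))) := by
      rw [h0]; exact hiter
    exact hiter'.comp (V₀, (0 : PBond (F.P K) 0 → lieSU (Fin N))) contDiff_mulExp.contDiffAt
  have hAB := hA.mul hB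
  have hval : star (iterMh j (V₀, (0 : PBond (F.P K) 0 → lieSU (Fin N))).1 c) *
      iterMh j (fun b => (V₀, (0 : PBond (F.P K) 0 → lieSU (Fin N))).1 b *
        NormedSpace.exp ((((V₀, (0 : PBond (F.P K) 0 → lieSU (Fin N))).2 b : lieSU (Fin N)) : Matrix (Fin N) (Fin N) ℂ))) c
      = star (iterMh j V₀ c) * iterMh j V₀ c := by
    rw [mulExp_zero V₀]
  have hmlog : ContDiffAt ℝ ⊤ (mlog : Matrix (Fin N) (Fin N) ℂ → Matrix (Fin N) (Fin N) ℂ)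
      (star (iterMh j (V₀, (0 : PBond (F.P K) 0 → lieSU (Fin N))).1 c) *
        iterMh j (fun b => (V₀, (0 : PBond (F.P K) 0 → lieSU (Fin N))).1 b *
          NormedSpace.exp ((((V₀, (0 : PBond (F.P K) 0 → lieSU (Fin N))).2 b : lieSU (Fin N)) : Matrix (Fin N) (Fin N) ℂ))) c) := by
    rw [hval]
    exact ((analyticAt_mlog hlog).contDiffAt).restrict_scalars ℝ
  have hcomp : ContDiffAt ℝ ⊤ (fun p : (PBond (F.P K) 0 → Matrix (Fin N) (Fin N) ℂ) × (PBond (F.P K) 0 → lieSU (Fin N)) =>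
      mlog (star (iterMh j p.1 c) * iterMh j (fun b => p.1 b * NormedSpace.exp ((p.2 b : lieSU (Fin N)) : Matrix (Fin N) (Fin N) ℂ)) c)) (V₀, 0) :=
    ContDiffAt.comp (g := (mlog : Matrix (Fin N) (Fin N) ℂ → Matrix (Fin N) (Fin N) ℂ))
      (f := fun p : (PBond (F.P K) 0 → Matrix (Fin N) (Fin N) ℂ) × (PBond (F.P K) 0 → lieSU (Fin N)) =>
        star (iterMh j p.1 c) * iterMh j (fun b => p.1 b * NormedSpace.exp ((p.2 b : lieSU (Fin N)) : Matrix (Fin N) (Fin N) ℂ)) c)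
      (V₀, (0 : PBond (F.P K) 0 → lieSU (Fin N))) hmlog hAB
  exact (suProj N).contDiff.contDiffAt.comp (V₀, (0 : PBond (F.P K) 0 → lieSU (Fin N))) hcomp

/-- ★ **ON THE FIBRE AND UNDER THE GUARD, THE CHART OF RECORD IS THE MODEL AT `V := ↑U₀`, NEAR `X = 0`**: for `U₀` guarded below `k` with `W = M˙(U₀)` on `𝐁`, the component of
`msChart F N K k 𝐁 W U₀` at the constrained bond `i ↔ (j,c)` equals `π(log((M_h^j ↑U₀ c)* · M_h^j(↑U₀ ⊙ e^X)(c)))` for `X` near `0` (the averages of `U₀·e^X` stay guarded, `relAvg_expChart_eq_of_smallBelow`, the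
smooth and holomorphic iterates agree under the guard). [cite: Balaban1987RG1, (0.4) p.253, (0.21) p.256; Balaban1988Convergent, (2.10)–(2.12) p.256] -/
theorem eventually_msChart_apply_eq_chartModel {k : ℕ} {𝔹 : DetSet (F.P K)} {W : MSField (F.P K) (SU N)} {U : GaugeField (F.P K) 0 (SU N)}
    (hU : AgreeOn 𝔹 (avgFamily (avOfRecord F N K) U) W) (hsb : SmallBelow (avOfRecord F N K) k U) (i : Fin (constrCard 𝔹 k)) :
    (fun X => msChart F N K k 𝔹 W U X i) =ᶠ[𝓝 (0 : PBond (F.P K) 0 → lieSU (Fin N))] fun X =>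
      suProj N (mlog (star (iterMh (((constrEnum 𝔹 k).symm i).1 : ℕ) (coeField U) ((constrEnum 𝔹 k).symm i).2.1) *
        iterMh (((constrEnum 𝔹 k).symm i).1 : ℕ) (fun b => coeField U b * NormedSpace.exp ((X b : lieSU (Fin N)) : Matrix (Fin N) (Fin N) ℂ))
          ((constrEnum 𝔹 k).symm i).2.1)) := by
  set s := (constrEnum 𝔹 k).symm i with hs
  have hj : (s.1 : ℕ) ≤ k := Nat.lt_succ_iff.1 s.1.2
  filter_upwards [eventually_smallBelow_expChart (P := F.P K) hsb] with X hX
  rw [msChart_apply, ← hs, relAvg_expChart_eq_of_smallBelow hX hj, ← hU s.1 s.2.1 s.2.2]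
  have hW : ((avgFamily (avOfRecord F N K) U s.1 s.2.1 : SU N) : Matrix (Fin N) (Fin N) ℂ) = iterMh (s.1 : ℕ) (coeField U) s.2.1 := by
    have h := B15AveragingHolomorphic.coeField_avgFamily_eq_iterMh (hsb.mono hj)
    exact congrFun h s.2.1
  have hX' : SmallBelow (fun j => blockAvg (P := F.P K) (j := j) expMeanLogSU) (s.1 : ℕ) (expChart U X) := hX.mono hj
  rw [hW, ← iterMh_coeField_eq_iterM (s.1 : ℕ) hX', coeField_expChart_eq_mulExp]

end Model

/-! ## §3  One radius below which every background is guarded, in the polydisc, and in the domain of the logarithm -/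

section Radius

variable {F : T4Family} {N : ℕ} [NeZero N] {K : ℕ}

/-- The flat configuration is guarded below every level for the averaging of record (Literature twin of dag-n12-w3's Summits lemma; `M^j(1) = 1` and the unit loop variables are at distance
`0` from `1`), stated as the eventual guard NEAR the flat configuration through dag-n12-w1's openness lemma. [cite: Balaban1987RG1, (0.4) p.253 (bookkeeping)] -/
theorem eventually_smallBelow_near_one (k : ℕ) :
    ∀ᶠ Q in 𝓝 (coeField (1 : GaugeField (F.P K) 0 (SU N))),
      ∀ U : GaugeField (F.P K) 0 (SU N), coeField U = Q → SmallBelow (avOfRecord F N K) k U := by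
  have h1 : SmallBelow (avOfRecord F N K) k (1 : GaugeField (F.P K) 0 (SU N)) := fun j _ c => by
    rw [B15Claim189UnitTestAtRecord.iter_avOfRecord_one F N K j]
    exact T3DescentFibreTower.small_one _ c
  exact eventually_smallBelow h1

/-- ★ **ONE RADIUS PER HEIGHT**: there is `ρ″ > 0` such that every matrix field `V` with `‖V − ↑1‖ ≤ ρ″` (i) is the field of a guarded `SU(N)` configuration whenever it is one, (ii) lies in
dag-n12-w1's polydisc below `k` (so `M_h^j`, `j ≤ k`, is smooth there), and (iii) has `‖(M_h^j V c)*·M_h^j V c − 1‖ < 1` for every `j ≤ k` and every `c` (the `log` of the model is analytic) —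
openness of the three conditions at the flat configuration (finitely many strict inequalities of continuous functions). [cite: Balaban1987RG1, (0.4) p.253, (0.21) p.256; Balaban1985Averaging, (21) p.21] -/
theorem exists_radius_chartModel (k : ℕ) :
    ∃ ρ'' : ℝ, 0 < ρ'' ∧ ∀ V : PBond (F.P K) 0 → Matrix (Fin N) (Fin N) ℂ, ‖V - (1 : PBond (F.P K) 0 → Matrix (Fin N) (Fin N) ℂ)‖ ≤ ρ'' →
      (∀ U : GaugeField (F.P K) 0 (SU N), coeField U = V → SmallBelow (avOfRecord F N K) k U) ∧
      (∀ j, j < k → ∀ (c : PBond (F.P K) (j + 1)) (i : Idx (F.P K)), ‖loopMh (iterMh j V) c i - 1‖ < 1) ∧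
      (∀ j, j ≤ k → ∀ c : PBond (F.P K) j, ‖star (iterMh j V c) * iterMh j V c - 1‖ < 1) := by
  have h1 : SmallBelow (fun j => blockAvg (P := F.P K) (j := j) expMeanLogSU) k (1 : GaugeField (F.P K) 0 (SU N)) := fun j _ c => by
    have h := B15Claim189UnitTestAtRecord.iter_avOfRecord_one F N K j
    rw [show Averaging.iter (fun j => blockAvg (P := F.P K) (j := j) expMeanLogSU) j (1 : GaugeField (F.P K) 0 (SU N)) = 1 from h]
    exact T3DescentFibreTower.small_one _ c
  have hi := eventually_smallBelow_near_one (F := F) (N := N) (K := K) k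
  have hii : ∀ᶠ Q in 𝓝 (coeField (1 : GaugeField (F.P K) 0 (SU N))),
      ∀ j, j < k → ∀ (c : PBond (F.P K) (j + 1)) (i : Idx (F.P K)), ‖loopMh (iterMh j Q) c i - 1‖ < 1 :=
    eventually_polydisc h1
  have hiii : ∀ᶠ Q in 𝓝 (coeField (1 : GaugeField (F.P K) 0 (SU N))),
      ∀ j : Fin (k + 1), ∀ c : PBond (F.P K) j, ‖star (iterMh (j : ℕ) Q c) * iterMh (j : ℕ) Q c - 1‖ < 1 := by
    refine eventually_all.2 fun j => eventually_all.2 fun c => ?_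
    have hjk : (j : ℕ) ≤ k := Nat.lt_succ_iff.1 j.2
    have hpoly1 : ∀ j', j' < (j : ℕ) → ∀ (c' : PBond (F.P K) (j' + 1)) (i : Idx (F.P K)),
        ‖loopMh (iterMh j' (coeField (1 : GaugeField (F.P K) 0 (SU N)))) c' i - 1‖ < 1 :=
      fun j' hj' c' i => (hii.self_of_nhds) j' (lt_of_lt_of_le hj' hjk) c' i
    have hcont : ContinuousAt (fun Q : PBond (F.P K) 0 → Matrix (Fin N) (Fin N) ℂ => star (iterMh (j : ℕ) Q c) * iterMh (j : ℕ) Q c)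
        (coeField (1 : GaugeField (F.P K) 0 (SU N))) := by
      have hiter : ContinuousAt (fun Q : PBond (F.P K) 0 → Matrix (Fin N) (Fin N) ℂ => iterMh (j : ℕ) Q c) (coeField (1 : GaugeField (F.P K) 0 (SU N))) :=
        ((continuous_apply c).continuousAt).comp ((contDiffAt_iterMh_of_polydisc (j : ℕ) hpoly1 (n := ⊤)).continuousAt)
      exact (hiter.star).mul hiter
    have hone : star (iterMh (j : ℕ) (coeField (1 : GaugeField (F.P K) 0 (SU N))) c) * iterMh (j : ℕ) (coeField (1 : GaugeField (F.P K) 0 (SU N))) c = 1 := by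
      rw [← coeField_iter_eq_iterMh (j : ℕ) (h1.mono hjk),
        show Averaging.iter (fun j => blockAvg (P := F.P K) (j := j) expMeanLogSU) (j : ℕ) (1 : GaugeField (F.P K) 0 (SU N)) = 1 from
          B15Claim189UnitTestAtRecord.iter_avOfRecord_one F N K j]
      have h1c : (1 : GaugeField (F.P K) (j : ℕ) (SU N)) c = 1 := rfl
      rw [coeField_apply, h1c]
      simp
    have hlt : ‖star (iterMh (j : ℕ) (coeField (1 : GaugeField (F.P K) 0 (SU N))) c) * iterMh (j : ℕ) (coeField (1 : GaugeField (F.P K) 0 (SU N))) c - 1‖ < 1 := by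
      rw [hone, sub_self, norm_zero]; exact one_pos
    exact (hcont.sub continuousAt_const).norm.eventually_lt continuousAt_const hlt
  have hc1 : coeField (1 : GaugeField (F.P K) 0 (SU N)) = (1 : PBond (F.P K) 0 → Matrix (Fin N) (Fin N) ℂ) := rfl
  obtain ⟨ε, hε, hball⟩ := Metric.eventually_nhds_iff_ball.1 (hi.and (hii.and hiii))
  refine ⟨ε / 2, by positivity, fun V hV => ?_⟩
  have hVb : V ∈ ball (coeField (1 : GaugeField (F.P K) 0 (SU N))) ε := by
    rw [mem_ball, dist_eq_norm, hc1]; linarith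
  obtain ⟨ha, hb, hc⟩ := hball V hVb
  exact ⟨ha, hb, fun j hj c => hc ⟨j, Nat.lt_succ_of_le hj⟩ c⟩

end Radius

/-! ## §4  One chart-curvature constant per height; the uniform (μ) letter -/

section Uniform

variable {F : T4Family} {N : ℕ} [NeZero N] {K : ℕ}

/-- ★★★ **ONE CHART-CURVATURE CONSTANT PER HEIGHT**: there are `M₂ ≥ 0` and `ρ″ > 0` such that (a) every background `U₀` with `‖↑U₀ − ↑1‖ ≤ ρ″` is guarded below `k` (so the chart is `C^∞`
at `0`, p610492's regularity binders apply), and (b) for EVERY determining set `𝐁` with no member above `k`, EVERY multi-scale datum `W`, and EVERY such `U₀` on the fibre of `W` (`M˙(U₀) = W`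
on `𝐁`): `‖D²Ψ(0)(w,w)‖ ≤ M₂·‖w‖²` for `Ψ := msChart F N K k 𝐁 W U₀` and all directions `w`.  (§1 on the compact ball `‖V − ↑1‖ ≤ ρ″` of matrix fields for the finite family of component
models, §2's identification of the chart with the model, §3's radius.)  LOCATED: `M₂` depends on the torus `F.P K` and on `k` (per height, as dag-n10-w1's `ρ′`), NOT print's volume-uniform
`O(1)`. [cite: Balaban1985Variational, Sect. C (44)–(48) p.285, (81)–(83) p.290; Balaban1989LargeFieldII, (1.12) p.359; Balaban1988Convergent, (2.10)–(2.12) p.256] -/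
theorem exists_uniform_chartCurvature_sq_bound (k : ℕ) :
    ∃ M₂ ρ'' : ℝ, 0 ≤ M₂ ∧ 0 < ρ'' ∧
      (∀ U₀ : GaugeField (F.P K) 0 (SU N), ‖coeField U₀ - 1‖ ≤ ρ'' → SmallBelow (avOfRecord F N K) k U₀) ∧
      ∀ (𝔹 : DetSet (F.P K)) (W : MSField (F.P K) (SU N)) (U₀ : GaugeField (F.P K) 0 (SU N)),
        ‖coeField U₀ - 1‖ ≤ ρ'' → AgreeOn 𝔹 (avgFamily (avOfRecord F N K) U₀) W →
        ∀ w : PBond (F.P K) 0 → lieSU (Fin N), ‖fderiv ℝ (fderiv ℝ (msChart F N K k 𝔹 W U₀)) 0 w w‖ ≤ M₂ * ‖w‖ ^ 2 := by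
  obtain ⟨ρ'', hρ, hrad⟩ := exists_radius_chartModel (F := F) (N := N) (K := K) k
  let f : (PBond (F.P K) 0 → Matrix (Fin N) (Fin N) ℂ) → (PBond (F.P K) 0 → lieSU (Fin N)) →
      (Σ j : Fin (k + 1), PBond (F.P K) j) → lieSU (Fin N) := fun V X s =>
    suProj N (mlog (star (iterMh (s.1 : ℕ) V s.2) * iterMh (s.1 : ℕ) (fun b => V b * NormedSpace.exp ((X b : lieSU (Fin N)) : Matrix (Fin N) (Fin N) ℂ)) s.2))
  have hS : IsCompact (closedBall (1 : PBond (F.P K) 0 → Matrix (Fin N) (Fin N) ℂ) ρ'') := isCompact_closedBall _ _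
  have hf : ∀ a ∈ closedBall (1 : PBond (F.P K) 0 → Matrix (Fin N) (Fin N) ℂ) ρ'', ContDiffAt ℝ 2 (Function.uncurry f) (a, 0) := by
    intro a ha
    rw [mem_closedBall, dist_eq_norm] at ha
    obtain ⟨-, hpoly, hlog⟩ := hrad a ha
    refine contDiffAt_pi.2 fun s => ?_
    have hs : (s.1 : ℕ) ≤ k := Nat.lt_succ_iff.1 s.1.2
    exact (contDiffAt_chartModel s.2 (fun j' hj' c' i => hpoly j' (lt_of_lt_of_le hj' hs) c' i) (hlog _ hs s.2)).of_le le_top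
  obtain ⟨C, hC, hbound⟩ := exists_sq_bound_on_compact_of_contDiffAt_two f hS hf
  refine ⟨C, ρ'', hC, hρ, fun U₀ hU₀ => (hrad (coeField U₀) hU₀).1 U₀ rfl, fun 𝔹 W U₀ hU₀ hU w => ?_⟩
  obtain ⟨hguard, -, -⟩ := hrad (coeField U₀) hU₀
  have hsb : SmallBelow (avOfRecord F N K) k U₀ := hguard U₀ rfl
  have hmem : coeField U₀ ∈ closedBall (1 : PBond (F.P K) 0 → Matrix (Fin N) (Fin N) ℂ) ρ'' := by
    rw [mem_closedBall, dist_eq_norm]; exact hU₀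
  have hfa : ContDiffAt ℝ 2 (f (coeField U₀)) 0 := by
    have h := hf _ hmem
    exact h.comp 0 (contDiffAt_const.prodMk contDiffAt_id)
  have hfa_d : ∀ᶠ X in 𝓝 (0 : PBond (F.P K) 0 → lieSU (Fin N)), DifferentiableAt ℝ (f (coeField U₀)) X :=
    (hfa.eventually (by simp)).mono fun X hX => hX.differentiableAt (by norm_num)
  have hfa_d2 : DifferentiableAt ℝ (fderiv ℝ (f (coeField U₀))) 0 :=
    ((hfa.fderiv_right (m := 1) (by norm_num)).differentiableAt (by norm_num))
  refine (pi_norm_le_iff_of_nonneg (by positivity)).2 fun i => ?_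
  set s : Σ j : Fin (k + 1), PBond (F.P K) j := ⟨((constrEnum 𝔹 k).symm i).1, ((constrEnum 𝔹 k).symm i).2.1⟩ with hs
  have h1 : fderiv ℝ (fderiv ℝ (msChart F N K k 𝔹 W U₀)) 0 w w i = fderiv ℝ (fderiv ℝ (fun X => msChart F N K k 𝔹 W U₀ X i)) 0 w w :=
    fderiv_fderiv_apply_pi (eventually_differentiableAt_msChart hU hsb) (hasFDerivAt_fderiv_msChart hU hsb).differentiableAt i w w
  have h2 : fderiv ℝ (fderiv ℝ (fun X => msChart F N K k 𝔹 W U₀ X i)) 0 = fderiv ℝ (fderiv ℝ (fun X => f (coeField U₀) X s)) 0 :=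
    fderiv_fderiv_congr_of_eventuallyEq (eventually_msChart_apply_eq_chartModel hU hsb i)
  have h3 : fderiv ℝ (fderiv ℝ (fun X => f (coeField U₀) X s)) 0 w w = fderiv ℝ (fderiv ℝ (f (coeField U₀))) 0 w w s :=
    (fderiv_fderiv_apply_pi hfa_d hfa_d2 s w w).symm
  rw [h1, h2, h3]
  exact (norm_le_pi_norm _ s).trans (hbound _ hmem w)

/-- The same against the junction's seminorm: `‖D²Ψ(0)(w,w)‖ ≤ N·M₂·p(w)²` when `Σ_b ‖↑w_b‖²_op ≤ p(w)²` (p613093's `pi_norm_le_sqrt_card_mul_seminorm`), with the guard clause carried along.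
[cite: Balaban1989LargeFieldII, (1.12) p.359; Balaban1985Averaging, (17)–(19) p.21] -/
theorem exists_uniform_chartCurvature_sq_bound_seminorm (k : ℕ) (p : Seminorm ℝ (PBond (F.P K) 0 → lieSU (Fin N)))
    (hp : ∀ Y : PBond (F.P K) 0 → lieSU (Fin N), ∑ b, ‖(Y b : Matrix (Fin N) (Fin N) ℂ)‖ ^ 2 ≤ p Y ^ 2) :
    ∃ M₂ ρ'' : ℝ, 0 ≤ M₂ ∧ 0 < ρ'' ∧
      (∀ U₀ : GaugeField (F.P K) 0 (SU N), ‖coeField U₀ - 1‖ ≤ ρ'' → SmallBelow (avOfRecord F N K) k U₀) ∧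
      ∀ (𝔹 : DetSet (F.P K)) (W : MSField (F.P K) (SU N)) (U₀ : GaugeField (F.P K) 0 (SU N)),
        ‖coeField U₀ - 1‖ ≤ ρ'' → AgreeOn 𝔹 (avgFamily (avOfRecord F N K) U₀) W →
        ∀ w : PBond (F.P K) 0 → lieSU (Fin N), ‖fderiv ℝ (fderiv ℝ (msChart F N K k 𝔹 W U₀)) 0 w w‖ ≤ N * M₂ * p w ^ 2 := by
  obtain ⟨M₂, ρ'', hM₂, hρ, hg, h⟩ := exists_uniform_chartCurvature_sq_bound (F := F) (N := N) (K := K) k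
  refine ⟨M₂, ρ'', hM₂, hρ, hg, fun 𝔹 W U₀ hU₀ hU w => (h 𝔹 W U₀ hU₀ hU w).trans ?_⟩
  have hw := pi_norm_le_sqrt_card_mul_seminorm p hp w
  have hN : (0 : ℝ) ≤ N := Nat.cast_nonneg _
  have hsq : ‖w‖ ^ 2 ≤ N * p w ^ 2 := by
    calc ‖w‖ ^ 2 ≤ (Real.sqrt N * p w) ^ 2 := pow_le_pow_left₀ (norm_nonneg _) hw 2
      _ = N * p w ^ 2 := by rw [mul_pow, Real.sq_sqrt hN]
  calc M₂ * ‖w‖ ^ 2 ≤ M₂ * (N * p w ^ 2) := mul_le_mul_of_nonneg_left hsq hM₂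
    _ = N * M₂ * p w ^ 2 := by ring

/-- ★★ **THE UNIFORM (μ) LETTER**: p613093's `exists_lam_mu_msChart_of_rightInverse_fun` with THIS `M₂` — ONE `M₂, ρ″` per height such that for every determining set with no member above `k`, every
datum, every background in the ball on its fibre, curve-critical there, with a right inverse `R` of `DΨ(0)` as a function (`p(Rv) ≤ ρ‖v‖`) and the current bound `|D(A∘expChart U₀)(0)x| ≤ j·p(x)`:
the multiplier exists with `lam(D²Ψ(0)(w,w)) ≤ (j·ρ·N·M₂)·p(w)²` — the ratio `μ∕(j·ρ) = N·M₂` no longer depends on the instance. [cite: Balaban1989LargeFieldII, (1.12) p.359, p.357; Balaban1985Variational, (82)–(83) p.290, (170)–(171) p.305, Sect. C (44)–(48) p.285] -/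
theorem exists_uniform_lam_mu_msChart (k : ℕ) (p : Seminorm ℝ (PBond (F.P K) 0 → lieSU (Fin N)))
    (hp : ∀ Y : PBond (F.P K) 0 → lieSU (Fin N), ∑ b, ‖(Y b : Matrix (Fin N) (Fin N) ℂ)‖ ^ 2 ≤ p Y ^ 2) :
    ∃ M₂ ρ'' : ℝ, 0 ≤ M₂ ∧ 0 < ρ'' ∧ ∀ (𝔹 : DetSet (F.P K)) (W : MSField (F.P K) (SU N)) (U₀ : GaugeField (F.P K) 0 (SU N)),
      (∀ j, k < j → 𝔹 j = ∅) → ‖coeField U₀ - 1‖ ≤ ρ'' →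
      AgreeOn 𝔹 (avgFamily (avOfRecord F N K) U₀) W → IsCritOnFibre F N K 𝔹 W U₀ →
      ∀ (R : (Fin (constrCard 𝔹 k) → lieSU (Fin N)) → PBond (F.P K) 0 → lieSU (Fin N)), (∀ v, fderiv ℝ (msChart F N K k 𝔹 W U₀) 0 (R v) = v) →
      ∀ (j ρ : ℝ), 0 ≤ j → 0 ≤ ρ →
      (∀ x, |fderiv ℝ (fun Y : PBond (F.P K) 0 → lieSU (Fin N) => wilsonAction4 (expChart U₀ Y)) 0 x| ≤ j * p x) →
      (∀ v, p (R v) ≤ ρ * ‖v‖) →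
      ∃ lam : (Fin (constrCard 𝔹 k) → lieSU (Fin N)) →L[ℝ] ℝ,
        fderiv ℝ (fun Y : PBond (F.P K) 0 → lieSU (Fin N) => wilsonAction4 (expChart U₀ Y)) 0 = lam.comp (fderiv ℝ (msChart F N K k 𝔹 W U₀) 0) ∧
          ∀ w : PBond (F.P K) 0 → lieSU (Fin N), lam (fderiv ℝ (fderiv ℝ (msChart F N K k 𝔹 W U₀)) 0 w w) ≤ (j * ρ * (N * M₂)) * p w ^ 2 := by
  obtain ⟨M₂, ρ'', hM₂, hρ'', hg, h⟩ := exists_uniform_chartCurvature_sq_bound_seminorm (F := F) (N := N) (K := K) k p hp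
  refine ⟨M₂, ρ'', hM₂, hρ'', fun 𝔹 W U₀ h𝔹 hU₀ hU hcrit R hR j ρ hj0 hρ0 hj hρ => ?_⟩
  have hsb : SmallBelow (avOfRecord F N K) k U₀ := hg U₀ hU₀
  obtain ⟨lam, hlam, hbd⟩ := exists_lam_msChart_bound_of_rightInverse_fun h𝔹 hU hsb p (fun v => ‖v‖) hR hj0 hj hρ hcrit
  refine ⟨lam, hlam, fun w => ?_⟩
  calc lam (fderiv ℝ (fderiv ℝ (msChart F N K k 𝔹 W U₀)) 0 w w)
        ≤ |lam (fderiv ℝ (fderiv ℝ (msChart F N K k 𝔹 W U₀)) 0 w w)| := le_abs_self _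
    _ ≤ j * ρ * ‖fderiv ℝ (fderiv ℝ (msChart F N K k 𝔹 W U₀)) 0 w w‖ := hbd _
    _ ≤ j * ρ * (N * M₂ * p w ^ 2) := mul_le_mul_of_nonneg_left (h 𝔹 W U₀ hU₀ hU w) (by positivity)
    _ = j * ρ * (N * M₂) * p w ^ 2 := by ring

end Uniform

end Literature.MathematicalPhysics.QuantumFieldTheory.Balaban1983to89.Node00

end
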